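import Summits.NavierStokesRegularity.NavierStokesRegularity.Theorems.PoloidalWindowDoorPoloidalWindowRigidityZShockNoetherConeEnergy
import Summits.NavierStokesRegularity.NavierStokesRegularity.Theorems.PoloidalWindowDoorPoloidalWindowRigidityZShockConeEnergy
import HarnessLib

/-!
# Crux K2 `PoloidalWindowRigidity` (stmt-NavierStokesRegularity-19708), line `z_shock` — the EXACT R3 entrance composed AT CLASS LEVEL:
# monotone cone-local Noether energy for the slice of a class profile on an autonomous, uniformly hyperbolic window (no exponential factor)

`--supports stmt-NavierStokesRegularity-19708 --as helper` (leafhand-ns-poloidalwindowdoor-3 g7, cell decomp-ns, 2026-08-31).  Def-free; tree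
files only.  **No stub and no summit is closed by this file; Navier–Stokes regularity is NOT proved here (rung 0).**

`noetherConeEnergy_of_class_autonomy` is the exact-energy twin of `…ZShockConeEnergy.coneEnergy_of_class_autonomy` (p827814).  Hypotheses:
the binders of the deciding stub `stub_zShockThickAut` (Type-I rate, continuity, Oseen identity, divergence-free, poloidal), its LOCAL
autonomy clause at `z₀ ∈ W₁`, an open preconnected non-degenerate region `Ω` of the slice `t₀ = z₀.1`, a truncated solid cone (slice chart
`pt c₀ 1 s y`, heights `t₁ ≤ s ≤ t₂`, slope `c ≥ 0`) charted into `Ω`, and — instead of p827814's pointwise hyperbolicity + speed bound —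
UNIFORM strict hyperbolicity with a floor `cmin > 0` and the speed bound in the form `−(∂₂vₕ·∇ₕw) ≤ c·cmin·|∇ₕw|²` (so that the Noether flux
speed `cmax²/cmin` of `…NoetherEnergyCoercive` is `≤ c`).  Conclusion: a smooth slope `Gs` (slope law on the cone), a reference value `w⋆`
and a smooth concave potential `Ψ` (`Ψ'' = Gs` near the values, centred: `Ψ'(w⋆) = 0`) such that the centred Noether density
`e = Ψ(w⋆) − Ψ(w) + ½|vₕ|²` of the slice is TWO-SIDED COMPARABLE to `(w − w⋆)² + |vₕ|²` on the cone
(`½cmin²(w−w⋆)² + ½|vₕ|² ≤ e ≤ ½c·cmin(w−w⋆)² + ½|vₕ|²`) and, for every `t ∈ [t₁, t₂]`,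

  `∫_{‖y‖ ≤ ρ} e(t, y) dy ≤ ∫_{‖y‖ ≤ √(1+ρ²) + c(t−t₁) + 1} e(t₁, y) dy`     (NO factor `e^{K(t−t₁)}`).

Route: slice analytic (`…Ancient.analyticOnNhd_slice`) ⇒ smooth; ONE analytic slope function on `Ω` (`…HeightEvolution.heightEvolution_of_class_
autonomy`); value interval of the cone and smooth localisation `Gs` (`…ConeValues`); `Γ = ∫_{w⋆} Gs`, `Ψ = ∫_{w⋆} Γ` (FTC, `contDiff_infty_iff_deriv`);
uniform bounds on `[α, β]` through attained values; then `…NoetherConeEnergy.noetherConeEnergy_le` (p828584) with `cmax² = c·cmin`, plus the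
upper concavity gap proved here (`concavityGap_le_of_slope_ge`).  Cone size / backward direction: class scaling + height reversal, as for
p827814.  It proves no rigidity (R3 is XL, not in print). [folklore]
-/

noncomputable section

namespace Summit.NavierStokesRegularity.NavierStokesRegularity.Theorems.PoloidalWindowDoorPoloidalWindowRigidityZShockNoetherConeEnergyClass

-- the problem directory repeats the summit name (`NavierStokesRegularity/NavierStokesRegularity`)
set_option linter.dupNamespace false

open Set Function Metric MeasureTheory intervalIntegral
open scoped ContDiff
open Literature.Analysis Literature.Analysis.FluidPDE
open Summit.NavierStokesRegularity.NavierStokesRegularity.Theorems.PoloidalWindowDoorPoloidalWindowRigidityHorizontalMean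
open Summit.NavierStokesRegularity.NavierStokesRegularity.Theorems.PoloidalWindowDoorPoloidalWindowRigidityZShockHeightEvolution
open Summit.NavierStokesRegularity.NavierStokesRegularity.Theorems.PoloidalWindowDoorPoloidalWindowRigidityZShockSliceTyping
open Summit.NavierStokesRegularity.NavierStokesRegularity.Theorems.PoloidalWindowDoorPoloidalWindowRigidityZShockConeValues
open Summit.NavierStokesRegularity.NavierStokesRegularity.Theorems.PoloidalWindowDoorPoloidalWindowRigidityZShockConeEnergy
open Summit.NavierStokesRegularity.NavierStokesRegularity.Theorems.PoloidalWindowDoorPoloidalWindowRigidityZShockNoetherEnergyCoercive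
open Summit.NavierStokesRegularity.NavierStokesRegularity.Theorems.PoloidalWindowDoorPoloidalWindowRigidityZShockNoetherConeEnergy

/-! ### Two calculus complements -/

/-- **Upper concavity gap.**  If `Γ' = G`, `Ψ' = Γ` everywhere, `Γ(w⋆) = 0`, and `−cmax² ≤ G` on `[[w⋆, w]]`, then
`Ψ(w⋆) − Ψ(w) ≤ ½cmax²(w − w⋆)²` (the lower gap `concavityGap_of_slope_le` applied to `−(Ψ + ½cmax²(· − w⋆)²)` with floor `0`). [folklore] -/
theorem concavityGap_le_of_slope_ge {G Γ Ψ : ℝ → ℝ} {wstar w cmax : ℝ}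
    (hΓ : ∀ r, HasDerivAt Γ (G r) r) (hΨ : ∀ r, HasDerivAt Ψ (Γ r) r) (hΓ0 : Γ wstar = 0)
    (hG : ∀ r ∈ uIcc wstar w, -cmax ^ 2 ≤ G r) :
    Ψ wstar - Ψ w ≤ (1 / 2) * cmax ^ 2 * (w - wstar) ^ 2 := by
  have hΓ3 : ∀ r, HasDerivAt (fun r => -(Γ r + cmax ^ 2 * (r - wstar))) (-(G r + cmax ^ 2)) r := by
    intro r
    have h : HasDerivAt (fun r => Γ r + cmax ^ 2 * (r - wstar)) (G r + cmax ^ 2 * 1) r :=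
      (hΓ r).add (((hasDerivAt_id r).sub_const wstar).const_mul (cmax ^ 2))
    exact h.neg.congr_deriv (by ring)
  have hΨ3 : ∀ r, HasDerivAt (fun r => -(Ψ r + (1 / 2) * cmax ^ 2 * (r - wstar) ^ 2)) (-(Γ r + cmax ^ 2 * (r - wstar))) r := by
    intro r
    have h0 : HasDerivAt (fun r => r - wstar) 1 r := (hasDerivAt_id r).sub_const wstar
    have h1 : HasDerivAt (fun r => (r - wstar) ^ 2) (((2 : ℕ) : ℝ) * (r - wstar) ^ (2 - 1) * 1) r := h0.pow 2
    have h : HasDerivAt (fun r => Ψ r + (1 / 2) * cmax ^ 2 * (r - wstar) ^ 2)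
        (Γ r + (1 / 2) * cmax ^ 2 * (((2 : ℕ) : ℝ) * (r - wstar) ^ (2 - 1) * 1)) r := (hΨ r).add (h1.const_mul _)
    exact h.neg.congr_deriv (by push_cast; ring)
  have h30 : -(Γ wstar + cmax ^ 2 * (wstar - wstar)) = 0 := by rw [hΓ0]; ring
  have key := concavityGap_of_slope_le (G := fun r => -(G r + cmax ^ 2)) (wstar := wstar) (w := w) (cmin := 0) hΓ3 hΨ3 h30
    (fun r hr => by have := hG r hr; simp only [ne_eq, OfNat.ofNat_ne_zero, not_false_eq_true, zero_pow, neg_zero]; linarith)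
  simp only [sub_self] at key
  nlinarith [key]

/-- **The primitive of a smooth function is smooth** (`r ↦ ∫_{a}^{r} g`), with the FTC derivative. [folklore] -/
theorem contDiff_primitive {g : ℝ → ℝ} (hg : ContDiff ℝ ∞ g) (a : ℝ) :
    ContDiff ℝ ∞ (fun r => ∫ x in a..r, g x) ∧ ∀ r, HasDerivAt (fun r => ∫ x in a..r, g x) (g r) r := by
  have hd : ∀ r, HasDerivAt (fun r => ∫ x in a..r, g x) (g r) r := fun r => (hg.continuous.integral_hasStrictDerivAt a r).hasDerivAt
  refine ⟨?_, hd⟩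
  rw [contDiff_infty_iff_deriv]
  refine ⟨fun r => (hd r).differentiableAt, ?_⟩
  rw [show deriv (fun r => ∫ x in a..r, g x) = g from funext fun r => (hd r).deriv]
  exact hg

/-! ### The class-level exact entrance -/

/-- ★ **Exact R3 entrance at class level: the cone-local centred Noether energy of a class slice is non-increasing in the height.**
See the module docstring.  [folklore] -/
theorem noetherConeEnergy_of_class_autonomy (C : ℝ) (v : ℝ → EuclideanSpace ℝ (Fin 3) → EuclideanSpace ℝ (Fin 3))
    (hrate : Literature.Analysis.FluidPDE.HasTypeITimeDecay C v)
    (hcont : ContinuousOn (Function.uncurry v) (Set.Iio (0 : ℝ) ×ˢ Set.univ))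
    (hmild : ∀ s t : ℝ, s < t → t < 0 → ∀ x, v t x =
      Literature.Analysis.UnboundedOperators.heatExtension (v s) (t - s) x -
        Literature.Analysis.FluidPDE.oseenDuhamel 1 s v v t x)
    (hdiv : ∀ t < 0, Literature.Analysis.FluidPDE.VectorCalculus.IsDivFree (v t))
    (hpol : ∀ s < 0, ∀ y, inner ℝ (Literature.Analysis.FluidPDE.curl (v s) y) (EuclideanSpace.single 2 1) = 0)
    {W₁ : Set (ℝ × EuclideanSpace ℝ (Fin 3))} (hW₁ : IsOpen W₁) (hW₁s : W₁ ⊆ Set.Iio (0 : ℝ) ×ˢ Set.univ)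
    {z₀ : ℝ × EuclideanSpace ℝ (Fin 3)} (hz₀ : z₀ ∈ W₁) {g : ℝ → ℝ → ℝ}
    (haut : ∀ z ∈ W₁, ∀ b : Fin 3, b ≠ 2 →
      fderiv ℝ (v z.1) z.2 (EuclideanSpace.single 2 1) b =
        g z.1 (v z.1 z.2 2) * fderiv ℝ (v z.1) z.2 (EuclideanSpace.single b 1) 2)
    {Ω : Set (EuclideanSpace ℝ (Fin 3))} (hΩ : IsPreconnected Ω) (hΩo : IsOpen Ω)
    (hΩnd : ∀ x ∈ Ω, fderiv ℝ (v z₀.1) x (EuclideanSpace.single 0 1) 2 ≠ 0 ∨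
      fderiv ℝ (v z₀.1) x (EuclideanSpace.single 1 1) 2 ≠ 0)
    (c₀ : EuclideanSpace ℝ (Fin 3)) {c cmin t₁ t₂ : ℝ} (hc : 0 ≤ c) (hcmin : 0 < cmin) (ht₁₂ : t₁ ≤ t₂) (ρ : ℝ)
    (hcone : ∀ s ∈ Icc t₁ t₂, ∀ y : EuclideanSpace ℝ (Fin 2), ‖y‖ ≤ √(1 + ρ ^ 2) + c * (t₂ - s) + 1 → pt c₀ 1 s y ∈ Ω)
    (hhyp : ∀ s ∈ Icc t₁ t₂, ∀ y : EuclideanSpace ℝ (Fin 2), ‖y‖ ≤ √(1 + ρ ^ 2) + c * (t₂ - s) + 1 →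
      -(fderiv ℝ (v z₀.1) (pt c₀ 1 s y) (EuclideanSpace.single 2 1) 0 * fderiv ℝ (v z₀.1) (pt c₀ 1 s y) (EuclideanSpace.single 0 1) 2 +
          fderiv ℝ (v z₀.1) (pt c₀ 1 s y) (EuclideanSpace.single 2 1) 1 * fderiv ℝ (v z₀.1) (pt c₀ 1 s y) (EuclideanSpace.single 1 1) 2) ≥
        cmin ^ 2 * (fderiv ℝ (v z₀.1) (pt c₀ 1 s y) (EuclideanSpace.single 0 1) 2 ^ 2 +
          fderiv ℝ (v z₀.1) (pt c₀ 1 s y) (EuclideanSpace.single 1 1) 2 ^ 2))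
    (hspeed : ∀ s ∈ Icc t₁ t₂, ∀ y : EuclideanSpace ℝ (Fin 2), ‖y‖ ≤ √(1 + ρ ^ 2) + c * (t₂ - s) + 1 →
      -(fderiv ℝ (v z₀.1) (pt c₀ 1 s y) (EuclideanSpace.single 2 1) 0 * fderiv ℝ (v z₀.1) (pt c₀ 1 s y) (EuclideanSpace.single 0 1) 2 +
          fderiv ℝ (v z₀.1) (pt c₀ 1 s y) (EuclideanSpace.single 2 1) 1 * fderiv ℝ (v z₀.1) (pt c₀ 1 s y) (EuclideanSpace.single 1 1) 2) ≤
        c * cmin * (fderiv ℝ (v z₀.1) (pt c₀ 1 s y) (EuclideanSpace.single 0 1) 2 ^ 2 +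
          fderiv ℝ (v z₀.1) (pt c₀ 1 s y) (EuclideanSpace.single 1 1) 2 ^ 2)) :
    ∃ Gs Ψ : ℝ → ℝ, ∃ wstar : ℝ, ContDiff ℝ ∞ Gs ∧ ContDiff ℝ ∞ Ψ ∧
      (∀ s ∈ Icc t₁ t₂, ∀ y : EuclideanSpace ℝ (Fin 2), ‖y‖ ≤ √(1 + ρ ^ 2) + c * (t₂ - s) + 1 →
        (∀ b : Fin 3, b ≠ 2 → fderiv ℝ (v z₀.1) (pt c₀ 1 s y) (EuclideanSpace.single 2 1) b =
          Gs (v z₀.1 (pt c₀ 1 s y) 2) * fderiv ℝ (v z₀.1) (pt c₀ 1 s y) (EuclideanSpace.single b 1) 2) ∧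
        (1 / 2) * cmin ^ 2 * (v z₀.1 (pt c₀ 1 s y) 2 - wstar) ^ 2 ≤ Ψ wstar - Ψ (v z₀.1 (pt c₀ 1 s y) 2) ∧
        Ψ wstar - Ψ (v z₀.1 (pt c₀ 1 s y) 2) ≤ (1 / 2) * (c * cmin) * (v z₀.1 (pt c₀ 1 s y) 2 - wstar) ^ 2) ∧
      ∀ t ∈ Icc t₁ t₂,
        ∫ y in closedBall (0 : EuclideanSpace ℝ (Fin 2)) ρ,
            (Ψ wstar - Ψ (v z₀.1 (pt c₀ 1 t y) 2) + (1 / 2) * (v z₀.1 (pt c₀ 1 t y) 0 ^ 2 + v z₀.1 (pt c₀ 1 t y) 1 ^ 2)) ≤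
          ∫ y in closedBall (0 : EuclideanSpace ℝ (Fin 2)) (√(1 + ρ ^ 2) + c * (t - t₁) + 1),
            (Ψ wstar - Ψ (v z₀.1 (pt c₀ 1 t₁ y) 2) + (1 / 2) * (v z₀.1 (pt c₀ 1 t₁ y) 0 ^ 2 + v z₀.1 (pt c₀ 1 t₁ y) 1 ^ 2)) := by
  -- Step 0: the slice is entire real-analytic, hence smooth
  have ht₀ : z₀.1 < 0 := (Set.mem_prod.1 (hW₁s hz₀)).1
  have hbdd : ∀ δ : ℝ, 0 < δ → ∃ B : ℝ, ∀ t < -δ, ∀ y : EuclideanSpace ℝ (Fin 3), ‖v t y‖ ≤ B := by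
    intro δ hδ
    refine ⟨|C| / Real.sqrt δ, fun t ht y => ?_⟩
    have hδt : δ ≤ -t := by linarith
    have hsq : Real.sqrt δ ≤ Real.sqrt (-t) := Real.sqrt_le_sqrt hδt
    have hsqpos : 0 < Real.sqrt δ := Real.sqrt_pos.2 hδ
    calc ‖v t y‖ ≤ C / Real.sqrt (-t) := hrate t (by linarith) y
      _ ≤ |C| / Real.sqrt (-t) := by gcongr; exact le_abs_self C
      _ ≤ |C| / Real.sqrt δ := by gcongr
  have han : AnalyticOnNhd ℝ (v z₀.1) univ :=
    Literature.Analysis.NavierStokesZoomKit.LocalSineTubeDoorProfileAlignedWindowRigidityAncient.analyticOnNhd_slice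
      hcont hbdd hmild ht₀
  have hvinf : ContDiff ℝ ∞ (v z₀.1) := han.contDiff
  set f := v z₀.1 with hfdef
  set W : ℝ → EuclideanSpace ℝ (Fin 2) → ℝ := fun s y => f (pt c₀ 1 s y) 2 with hWdef
  have hW : ContDiff ℝ ∞ (uncurry W) := contDiff_slice_uncurry (contDiff_apply_two hvinf) c₀
  have hWc : Continuous (uncurry W) := hW.continuous
  -- Step 1: ONE analytic slope function on `Ω` with the slope law
  obtain ⟨G, hGA, hGslope, -⟩ :=
    heightEvolution_of_class_autonomy C v hrate hcont hmild hdiv hpol hW₁ hW₁s hz₀ haut hΩ hΩo hΩnd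
  -- Step 2: uniform bounds on `G` at cone values: `G ≤ -cmin²`, `-G ≤ c·cmin`
  have hGbd : ∀ s ∈ Icc t₁ t₂, ∀ y : EuclideanSpace ℝ (Fin 2), ‖y‖ ≤ √(1 + ρ ^ 2) + c * (t₂ - s) + 1 →
      G (W s y) ≤ -cmin ^ 2 ∧ -G (W s y) ≤ c * cmin := by
    intro s hs y hy
    have hx := hcone s hs y hy
    have h0 := hGslope _ hx 0 (by decide)
    have h1 := hGslope _ hx 1 (by decide)
    set a := fderiv ℝ f (pt c₀ 1 s y) (EuclideanSpace.single 0 1) 2 with ha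
    set b := fderiv ℝ f (pt c₀ 1 s y) (EuclideanSpace.single 1 1) 2 with hb
    have hD : 0 < a ^ 2 + b ^ 2 := by
      rcases hΩnd _ hx with h | h
      · have : 0 < a ^ 2 := by positivity
        nlinarith [sq_nonneg b]
      · have : 0 < b ^ 2 := by positivity
        nlinarith [sq_nonneg a]
    have hlo := hhyp s hs y hy
    have hhi := hspeed s hs y hy
    rw [h0, h1] at hlo hhi
    have hsum : -(G (f (pt c₀ 1 s y) 2) * a * a + G (f (pt c₀ 1 s y) 2) * b * b) = -G (W s y) * (a ^ 2 + b ^ 2) := by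
      simp only [hWdef]; ring
    rw [hsum] at hlo hhi
    constructor
    · have := le_of_mul_le_mul_right (hlo.le.trans_eq' (by ring) : cmin ^ 2 * (a ^ 2 + b ^ 2) ≤ -G (W s y) * (a ^ 2 + b ^ 2)) hD
      linarith
    · exact le_of_mul_le_mul_right hhi hD
  -- Step 3: the value interval of the cone and the smooth localisation `Gs`
  obtain ⟨α, β, hαβ, hrange, hsurj⟩ := exists_value_Icc_of_solidCone hWc ht₁₂ ρ (c := c)
  obtain ⟨Gs, hGs, hGsW⟩ := exists_smooth_slope_on_solidCone hWc ht₁₂ ρ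
    (fun s hs y hy => hGA _ (hcone s hs y hy))
  have hGsI : ∀ r ∈ Icc α β, Gs r ≤ -cmin ^ 2 ∧ |Gs r| ≤ c * cmin := by
    intro r hr
    obtain ⟨s, hs, y, hy, hWr⟩ := hsurj r hr
    obtain ⟨hval, -, -⟩ := hGsW s hs y hy
    obtain ⟨hlo, hhi⟩ := hGbd s hs y hy
    rw [← hWr, hval]
    refine ⟨hlo, ?_⟩
    rw [abs_of_neg (by nlinarith [sq_nonneg cmin, hcmin])]
    exact hhi
  -- Step 4: the centred antiderivatives `Γ = ∫_{w⋆} Gs`, `Ψ = ∫_{w⋆} Γ`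
  set wstar : ℝ := W t₁ 0 with hwstar_def
  have hwstar : wstar ∈ Icc α β := hrange t₁ ⟨le_rfl, ht₁₂⟩ 0 (by simp; positivity)
  obtain ⟨hΓs, hΓd⟩ := contDiff_primitive hGs wstar
  set Γ : ℝ → ℝ := fun r => ∫ x in wstar..r, Gs x with hΓ_def
  obtain ⟨hΨs, hΨd⟩ := contDiff_primitive hΓs wstar
  set Ψ : ℝ → ℝ := fun r => ∫ x in wstar..r, Γ x with hΨ_def
  have hΓ0 : Γ wstar = 0 := by simp [hΓ_def]
  -- Step 5: assemble
  have hseg : ∀ {w : ℝ}, w ∈ Icc α β → uIcc wstar w ⊆ Icc α β := fun hw => uIcc_subset_Icc hwstar hw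
  have hcc : 0 ≤ c * cmin := mul_nonneg hc hcmin.le
  have hsq : Real.sqrt (c * cmin) ^ 2 = c * cmin := Real.sq_sqrt hcc
  have hĉ : Real.sqrt (c * cmin) ^ 2 / cmin = c := by rw [hsq, mul_div_assoc, div_self hcmin.ne', mul_one]
  refine ⟨Gs, Ψ, wstar, hGs, hΨs, fun s hs y hy => ?_, fun t ht => ?_⟩
  · obtain ⟨hval, -, -⟩ := hGsW s hs y hy
    have hx := hcone s hs y hy
    have hvI : W s y ∈ Icc α β := hrange s hs y hy
    refine ⟨fun b hb => ?_, ?_, ?_⟩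
    · rw [hGslope _ hx b hb, ← hval]
    · exact concavityGap_of_slope_le (w := W s y) hΓd hΨd hΓ0 (fun r hr => (hGsI r (hseg hvI hr)).1)
    · have hGlow : ∀ r ∈ uIcc wstar (W s y), -(Real.sqrt (c * cmin)) ^ 2 ≤ Gs r := fun r hr => by
        have h2 := (hGsI r (hseg hvI hr)).2
        rw [hsq]
        linarith [neg_abs_le (Gs r)]
      have h := concavityGap_le_of_slope_ge (w := W s y) hΓd hΨd hΓ0 hGlow
      rw [hsq] at h
      exact h
  · -- the exact cone inequality on the sub-cone with top `t`
    have hsub : ∀ s ∈ Icc t₁ t, ∀ y : EuclideanSpace ℝ (Fin 2), ‖y‖ ≤ √(1 + ρ ^ 2) + c * (t - s) + 1 →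
        s ∈ Icc t₁ t₂ ∧ ‖y‖ ≤ √(1 + ρ ^ 2) + c * (t₂ - s) + 1 := fun s hs y hy => cone_mono hc ht.2 hs hy
    have key := noetherConeEnergy_le (f := f) (G := Gs) (Γ := Γ) (Ψ := Ψ) (c := c₀) (α := α) (β := β) (wstar := wstar)
      (cmin := cmin) (cmax := Real.sqrt (c * cmin)) (t₀ := t₁) (t := t) (ρ := ρ)
      hvinf hΓs hΨs hΓd hΨd hΓ0 hwstar hcmin (fun r hr => (hGsI r hr).1) (fun r hr => by rw [hsq]; exact (hGsI r hr).2) ht.1 ?_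
    · rw [hĉ] at key
      simpa only [hWdef] using key
    · intro s hs y hy
      rw [hĉ] at hy
      obtain ⟨hs', hy'⟩ := hsub s hs y hy
      obtain ⟨hval, -, -⟩ := hGsW s hs' y hy'
      have hx := hcone s hs' y hy'
      refine ⟨hrange s hs' y hy', hdiv z₀.1 ht₀ _, fun b hb => ?_⟩
      rw [hGslope _ hx b hb, ← hval]

/-- ★ **L² cone stability of the centred state (class level, explicit constants, no potential in the statement).**  Under the
hypotheses of `noetherConeEnergy_of_class_autonomy` there is a reference value `w⋆` such that for every `t ∈ [t₁, t₂]`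
`∫_{‖y‖≤ρ} [½cmin²(v₂ − w⋆)² + ½(v₀² + v₁²)](t) ≤ ∫_{‖y‖≤√(1+ρ²)+c(t−t₁)+1} [½c·cmin(v₂ − w⋆)² + ½(v₀² + v₁²)](t₁)` on the slice chart:
the exact Noether inequality sandwiched by the two concavity gaps.  (Appended by the same hand.) [folklore] -/
theorem coneStability_of_class_autonomy (C : ℝ) (v : ℝ → EuclideanSpace ℝ (Fin 3) → EuclideanSpace ℝ (Fin 3))
    (hrate : Literature.Analysis.FluidPDE.HasTypeITimeDecay C v)
    (hcont : ContinuousOn (Function.uncurry v) (Set.Iio (0 : ℝ) ×ˢ Set.univ))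
    (hmild : ∀ s t : ℝ, s < t → t < 0 → ∀ x, v t x =
      Literature.Analysis.UnboundedOperators.heatExtension (v s) (t - s) x -
        Literature.Analysis.FluidPDE.oseenDuhamel 1 s v v t x)
    (hdiv : ∀ t < 0, Literature.Analysis.FluidPDE.VectorCalculus.IsDivFree (v t))
    (hpol : ∀ s < 0, ∀ y, inner ℝ (Literature.Analysis.FluidPDE.curl (v s) y) (EuclideanSpace.single 2 1) = 0)
    {W₁ : Set (ℝ × EuclideanSpace ℝ (Fin 3))} (hW₁ : IsOpen W₁) (hW₁s : W₁ ⊆ Set.Iio (0 : ℝ) ×ˢ Set.univ)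
    {z₀ : ℝ × EuclideanSpace ℝ (Fin 3)} (hz₀ : z₀ ∈ W₁) {g : ℝ → ℝ → ℝ}
    (haut : ∀ z ∈ W₁, ∀ b : Fin 3, b ≠ 2 →
      fderiv ℝ (v z.1) z.2 (EuclideanSpace.single 2 1) b =
        g z.1 (v z.1 z.2 2) * fderiv ℝ (v z.1) z.2 (EuclideanSpace.single b 1) 2)
    {Ω : Set (EuclideanSpace ℝ (Fin 3))} (hΩ : IsPreconnected Ω) (hΩo : IsOpen Ω)
    (hΩnd : ∀ x ∈ Ω, fderiv ℝ (v z₀.1) x (EuclideanSpace.single 0 1) 2 ≠ 0 ∨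
      fderiv ℝ (v z₀.1) x (EuclideanSpace.single 1 1) 2 ≠ 0)
    (c₀ : EuclideanSpace ℝ (Fin 3)) {c cmin t₁ t₂ : ℝ} (hc : 0 ≤ c) (hcmin : 0 < cmin) (ht₁₂ : t₁ ≤ t₂) (ρ : ℝ)
    (hcone : ∀ s ∈ Icc t₁ t₂, ∀ y : EuclideanSpace ℝ (Fin 2), ‖y‖ ≤ √(1 + ρ ^ 2) + c * (t₂ - s) + 1 → pt c₀ 1 s y ∈ Ω)
    (hhyp : ∀ s ∈ Icc t₁ t₂, ∀ y : EuclideanSpace ℝ (Fin 2), ‖y‖ ≤ √(1 + ρ ^ 2) + c * (t₂ - s) + 1 →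
      -(fderiv ℝ (v z₀.1) (pt c₀ 1 s y) (EuclideanSpace.single 2 1) 0 * fderiv ℝ (v z₀.1) (pt c₀ 1 s y) (EuclideanSpace.single 0 1) 2 +
          fderiv ℝ (v z₀.1) (pt c₀ 1 s y) (EuclideanSpace.single 2 1) 1 * fderiv ℝ (v z₀.1) (pt c₀ 1 s y) (EuclideanSpace.single 1 1) 2) ≥
        cmin ^ 2 * (fderiv ℝ (v z₀.1) (pt c₀ 1 s y) (EuclideanSpace.single 0 1) 2 ^ 2 +
          fderiv ℝ (v z₀.1) (pt c₀ 1 s y) (EuclideanSpace.single 1 1) 2 ^ 2))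
    (hspeed : ∀ s ∈ Icc t₁ t₂, ∀ y : EuclideanSpace ℝ (Fin 2), ‖y‖ ≤ √(1 + ρ ^ 2) + c * (t₂ - s) + 1 →
      -(fderiv ℝ (v z₀.1) (pt c₀ 1 s y) (EuclideanSpace.single 2 1) 0 * fderiv ℝ (v z₀.1) (pt c₀ 1 s y) (EuclideanSpace.single 0 1) 2 +
          fderiv ℝ (v z₀.1) (pt c₀ 1 s y) (EuclideanSpace.single 2 1) 1 * fderiv ℝ (v z₀.1) (pt c₀ 1 s y) (EuclideanSpace.single 1 1) 2) ≤
        c * cmin * (fderiv ℝ (v z₀.1) (pt c₀ 1 s y) (EuclideanSpace.single 0 1) 2 ^ 2 +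
          fderiv ℝ (v z₀.1) (pt c₀ 1 s y) (EuclideanSpace.single 1 1) 2 ^ 2)) :
    ∃ wstar : ℝ, ∀ t ∈ Icc t₁ t₂,
      ∫ y in closedBall (0 : EuclideanSpace ℝ (Fin 2)) ρ,
          ((1 / 2) * cmin ^ 2 * (v z₀.1 (pt c₀ 1 t y) 2 - wstar) ^ 2 +
            (1 / 2) * (v z₀.1 (pt c₀ 1 t y) 0 ^ 2 + v z₀.1 (pt c₀ 1 t y) 1 ^ 2)) ≤
        ∫ y in closedBall (0 : EuclideanSpace ℝ (Fin 2)) (√(1 + ρ ^ 2) + c * (t - t₁) + 1),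
          ((1 / 2) * (c * cmin) * (v z₀.1 (pt c₀ 1 t₁ y) 2 - wstar) ^ 2 +
            (1 / 2) * (v z₀.1 (pt c₀ 1 t₁ y) 0 ^ 2 + v z₀.1 (pt c₀ 1 t₁ y) 1 ^ 2)) := by
  obtain ⟨Gs, Ψ, wstar, -, hΨs, hpt, hint⟩ := noetherConeEnergy_of_class_autonomy C v hrate hcont hmild hdiv hpol hW₁ hW₁s hz₀ haut
    hΩ hΩo hΩnd c₀ hc hcmin ht₁₂ ρ hcone hhyp hspeed
  -- continuity of the slice (it is entire real-analytic)
  have ht₀ : z₀.1 < 0 := (Set.mem_prod.1 (hW₁s hz₀)).1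
  have hbdd : ∀ δ : ℝ, 0 < δ → ∃ B : ℝ, ∀ t < -δ, ∀ y : EuclideanSpace ℝ (Fin 3), ‖v t y‖ ≤ B := by
    intro δ hδ
    refine ⟨|C| / Real.sqrt δ, fun t ht y => ?_⟩
    have hδt : δ ≤ -t := by linarith
    have hsq : Real.sqrt δ ≤ Real.sqrt (-t) := Real.sqrt_le_sqrt hδt
    have hsqpos : 0 < Real.sqrt δ := Real.sqrt_pos.2 hδ
    calc ‖v t y‖ ≤ C / Real.sqrt (-t) := hrate t (by linarith) y
      _ ≤ |C| / Real.sqrt (-t) := by gcongr; exact le_abs_self C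
      _ ≤ |C| / Real.sqrt δ := by gcongr
  have hvc : Continuous (v z₀.1) :=
    (Literature.Analysis.NavierStokesZoomKit.LocalSineTubeDoorProfileAlignedWindowRigidityAncient.analyticOnNhd_slice
      hcont hbdd hmild ht₀).continuous
  have hvi : ∀ i : Fin 3, Continuous fun x => v z₀.1 x i := fun i => (EuclideanSpace.proj (𝕜 := ℝ) i).continuous.comp hvc
  have hptc : ∀ s : ℝ, Continuous fun y : EuclideanSpace ℝ (Fin 2) => pt c₀ 1 s y := by
    intro s
    have hfun : (fun y : EuclideanSpace ℝ (Fin 2) => pt c₀ 1 s y) =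
        fun y => c₀ + hor y + s • EuclideanSpace.single (2 : Fin 3) (1 : ℝ) := funext fun y => pt_one c₀ s y
    rw [hfun]
    exact (continuous_const.add hor.continuous).add continuous_const
  have hslice : ∀ (s : ℝ) (i : Fin 3), Continuous fun y : EuclideanSpace ℝ (Fin 2) => v z₀.1 (pt c₀ 1 s y) i :=
    fun s i => (hvi i).comp (hptc s)
  have hΨc : Continuous Ψ := hΨs.continuous
  refine ⟨wstar, fun t ht => ?_⟩
  have hmain := hint t ht
  -- lower sandwich at height `t`, upper sandwich at height `t₁`
  have hlow : ∫ y in closedBall (0 : EuclideanSpace ℝ (Fin 2)) ρ,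
        ((1 / 2) * cmin ^ 2 * (v z₀.1 (pt c₀ 1 t y) 2 - wstar) ^ 2 +
          (1 / 2) * (v z₀.1 (pt c₀ 1 t y) 0 ^ 2 + v z₀.1 (pt c₀ 1 t y) 1 ^ 2)) ≤
      ∫ y in closedBall (0 : EuclideanSpace ℝ (Fin 2)) ρ,
        (Ψ wstar - Ψ (v z₀.1 (pt c₀ 1 t y) 2) + (1 / 2) * (v z₀.1 (pt c₀ 1 t y) 0 ^ 2 + v z₀.1 (pt c₀ 1 t y) 1 ^ 2)) := by
    refine setIntegral_mono_on ?_ ?_ measurableSet_closedBall fun y hy => ?_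
    · exact ((((continuous_const.mul (((hslice t 2).sub continuous_const).pow 2)).add
        (continuous_const.mul (((hslice t 0).pow 2).add ((hslice t 1).pow 2))))).continuousOn.integrableOn_compact
        (isCompact_closedBall _ _))
    · exact (((continuous_const.sub (hΨc.comp (hslice t 2))).add
        (continuous_const.mul (((hslice t 0).pow 2).add ((hslice t 1).pow 2)))).continuousOn.integrableOn_compact
        (isCompact_closedBall _ _))
    · rw [mem_closedBall, dist_zero_right] at hy
      have hy' : ‖y‖ ≤ √(1 + ρ ^ 2) + c * (t₂ - t) + 1 := by
        have h1 : ρ ≤ √(1 + ρ ^ 2) := by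
          calc ρ ≤ |ρ| := le_abs_self ρ
            _ = √(ρ ^ 2) := (Real.sqrt_sq_eq_abs ρ).symm
            _ ≤ √(1 + ρ ^ 2) := Real.sqrt_le_sqrt (by linarith)
        nlinarith [mul_nonneg hc (sub_nonneg.2 ht.2)]
      have := (hpt t ht y hy').2.1
      linarith
  have hup : ∫ y in closedBall (0 : EuclideanSpace ℝ (Fin 2)) (√(1 + ρ ^ 2) + c * (t - t₁) + 1),
        (Ψ wstar - Ψ (v z₀.1 (pt c₀ 1 t₁ y) 2) + (1 / 2) * (v z₀.1 (pt c₀ 1 t₁ y) 0 ^ 2 + v z₀.1 (pt c₀ 1 t₁ y) 1 ^ 2)) ≤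
      ∫ y in closedBall (0 : EuclideanSpace ℝ (Fin 2)) (√(1 + ρ ^ 2) + c * (t - t₁) + 1),
        ((1 / 2) * (c * cmin) * (v z₀.1 (pt c₀ 1 t₁ y) 2 - wstar) ^ 2 +
          (1 / 2) * (v z₀.1 (pt c₀ 1 t₁ y) 0 ^ 2 + v z₀.1 (pt c₀ 1 t₁ y) 1 ^ 2)) := by
    refine setIntegral_mono_on ?_ ?_ measurableSet_closedBall fun y hy => ?_
    · exact (((continuous_const.sub (hΨc.comp (hslice t₁ 2))).add
        (continuous_const.mul (((hslice t₁ 0).pow 2).add ((hslice t₁ 1).pow 2)))).continuousOn.integrableOn_compact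
        (isCompact_closedBall _ _))
    · exact ((((continuous_const.mul (((hslice t₁ 2).sub continuous_const).pow 2)).add
        (continuous_const.mul (((hslice t₁ 0).pow 2).add ((hslice t₁ 1).pow 2))))).continuousOn.integrableOn_compact
        (isCompact_closedBall _ _))
    · rw [mem_closedBall, dist_zero_right] at hy
      have hy' : ‖y‖ ≤ √(1 + ρ ^ 2) + c * (t₂ - t₁) + 1 := by nlinarith [mul_nonneg hc (sub_nonneg.2 ht.2)]
      have := (hpt t₁ ⟨le_rfl, ht₁₂⟩ y hy').2.2
      linarith
  exact hlow.trans (hmain.trans hup)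

end Summit.NavierStokesRegularity.NavierStokesRegularity.Theorems.PoloidalWindowDoorPoloidalWindowRigidityZShockNoetherConeEnergyClass
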